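import Mathlib
import HarnessLib
import Literature.MathematicalPhysics.QuantumManyBody.LangevinGenerator
import Literature.MathematicalPhysics.QuantumManyBody.PeriodicConfigLaplacian
import Literature.MathematicalPhysics.QuantumManyBody.PeriodicFormCoreTrigPoly
import Summits.AtomisticToContinuum.BoseEinsteinCondensation.Theorems.BECConjugateDominationInfraredMinimumUncertaintyWeakEulerLagrange

/-!
# Route `BECNewtonPolicyIteration` — support item `PolicyImprovementIdentity`
# (stmt-AtomisticToContinuum-9319), part 4b/5: from the weak Poisson equation to the Newton step
# almost everywhere (bounded measurable interaction)

Helper file (`--supports stmt-AtomisticToContinuum-9319`; independent of parts 1–4). Companion of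
`…PolicyImprovementIdentityWeakToStrong.lean` (continuous interaction ⇒ pointwise step). For the
route's full class of potentials — measurable profiles `v` with BOUNDED periodic interaction
`W = ∑_{i<j} v^per ≤ Cw < ∞` (e.g. any bounded finite-range profile, continuity not required) — the
local energy `E_loc = ΔS - |∇S|² + W` is only measurable, and the weak equation for the correction
`δ ∈ C²` gives the Newton step `L_{e^{-S}} δ = -(E_loc - E)` Lebesgue-a.e. on the fundamental cell,
which is all that Barta's inequality (a.e. form, part 2/5) needs.

* `ae_eq_zero_of_forall_isPeriodicTest_integral_mul_eq_zero` — **du Bois-Reymond against the `C¹`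
  periodic core, `L²` form**: a measurable real `h` bounded on `[0,L]^{3N}` with `∫_{cell} φ h = 0` for
  all periodic test `φ` vanishes a.e. on the cell (its Fourier coefficients vanish; Parseval
  `UnitAddTorus.hasSum_sq_mFourierCoeff` for the bounded torus function `h ∘ fromUnitTorusN`,
  transported by `integral_fromUnitTorusN`).
* `integral_mul_residual_mul_sq_of_integrable` — orthogonality of the residual `L_F δ + g` to the
  test core for integrable (not necessarily continuous) `g` (as `IsWeakCorrector.integral_mul_residual_mul_sq`).
* `newtonStep_ae_of_weakCorrector`, `localEnergy_newtonStep_ae` — the a.e. Newton step and the a.e.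
  policy-improvement identity `E'_loc = E - |∇δ|²` from the weak equation with `C²` data.

References: R. A. Howard, *Dynamic Programming and Markov Processes* (1960) (policy improvement);
M. L. Puterman, S. L. Brumelle, Math. Oper. Res. 4 (1979) 60 (policy iteration = Newton–Kantorovich);
C. J. Holland, CPAM 31 (1978) 509 (logarithmic transform; min–max for the principal eigenvalue);
J. Barta, C. R. Acad. Sci. Paris 204 (1937) 472 (Barta's inequality `inf (Hφ)/φ ≤ E₀`, `φ > 0`);
W. Thirring, *Quantum Mathematical Physics*, §3.5; [ReedSimonIV1978] §XIII.12; [BakryGentilLedoux2014]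
§1.11.3 (`Γ`-calculus, Green's identity); [KipnisLandim1999] App. 1 §6 (weak Poisson equation);
[Fournais2020] (1.1)–(1.2) (the periodic problem); L. Grafakos, *Classical Fourier Analysis* (2014),
Prop. 3.2.7 (Parseval on the torus).
-/

noncomputable section

open MeasureTheory Filter Set
open scoped ENNReal NNReal Topology InnerProductSpace ComplexConjugate BigOperators

namespace Summit.AtomisticToContinuum.BoseEinsteinCondensation.Theorems

open Literature.MathematicalPhysics.QuantumManyBody.BoseGas

namespace PolicyImprovement

open ImuWeakEulerLagrange (integrableOn_toReal_interaction_mul)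

-- The measure on `ℝ/ℤ` is the Haar PROBABILITY measure, as in `PeriodicConfigFourier.lean` (and Mathlib's
-- `AddCircleMulti`), so that `configFourierCoeff`, `integral_fromUnitTorusN` and Parseval apply verbatim.
attribute [local instance] configFourier_measureSpace configFourier_isProbabilityMeasure
  configFourier_isProbabilityMeasure_pi

variable {N : ℕ} {L : ℝ} {v : ℝ → ℝ≥0∞} {Cw : ℝ≥0∞}

/-! ### du Bois-Reymond on the torus, `L²` (a.e.) form -/

section AE

/-- A measurable function bounded on the fundamental cell, times a continuous one, is integrable on
the cell (finite measure). [folklore] -/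
theorem integrableOn_cellN_mul_of_bound {h : Config N → ℝ} (hmeas : Measurable h) {C : ℝ}
    (hbdd : ∀ X ∈ cellN N L, |h X| ≤ C) {φ : Config N → ℝ} (hφ : Continuous φ) :
    IntegrableOn (fun X => φ X * h X) (cellN N L) volume := by
  refine Integrable.mul_bdd (c := C) (integrableOn_cellN hφ L) hmeas.aestronglyMeasurable ?_
  exact (ae_restrict_mem (measurableSet_cellN N L)).mono fun X hX => by
    rw [Real.norm_eq_abs]; exact hbdd X hX

/-- **du Bois-Reymond against the `C¹` periodic core, a.e. form.** A measurable real `h`, bounded on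
the closed box `[0,L]^{3N}`, with `∫_{cell} φ h = 0` for every periodic test function `φ`, vanishes
a.e. on the fundamental cell: its Fourier coefficients all vanish (test with `Re`/`Im` of the plane
waves `cellWaveN`), so Parseval in `L²((ℝ/ℤ)^{3N})` (`UnitAddTorus.hasSum_sq_mFourierCoeff`) for the
bounded torus function `h ∘ fromUnitTorusN` gives `∫_{cell} h² = 0`. [folklore] -/
theorem ae_eq_zero_of_forall_isPeriodicTest_integral_mul_eq_zero (hL : 0 < L) {h : Config N → ℝ}
    (hmeas : Measurable h) {C : ℝ}
    (hbdd : ∀ X ∈ {X : Config N | ∀ i, X i ∈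
      (WithLp.toLp 2 '' Set.univ.pi fun _ : Fin 3 => Icc (0 : ℝ) L : Set Space)}, |h X| ≤ C)
    (horth : ∀ φ : Config N → ℝ, IsPeriodicTest L φ → ∫ X in cellN N L, φ X * h X = 0) :
    ∀ᵐ X ∂(volume.restrict (cellN N L)), h X = 0 := by
  set H : Config N → ℂ := fun Y => ((h Y : ℝ) : ℂ) with hH
  have hHm : Measurable H := Complex.measurable_ofReal.comp hmeas
  have hcell : ∀ X ∈ cellN N L, |h X| ≤ C := fun X hX => hbdd X (cellN_subset_closedBoxN N L hX)
  -- every Fourier coefficient of `H` vanishes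
  have hcoeff : ∀ n, configFourierCoeff L H n = 0 := by
    intro n
    rw [configFourierCoeff_eq_integral hL hHm.aestronglyMeasurable]
    have hre := horth (fun X => (cellWaveN L n X).re)
      ⟨Complex.reCLM.contDiff.comp (contDiff_cellWaveN L n), fun X i k => by
        simp only [cellWaveN_periodic hL.ne' n X i k]⟩
    have him := horth (fun X => (cellWaveN L n X).im)
      ⟨Complex.imCLM.contDiff.comp (contDiff_cellWaveN L n), fun X i k => by
        simp only [cellWaveN_periodic hL.ne' n X i k]⟩
    have hpt : ∀ Y, conj (cellWaveN L n Y) * H Y =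
        (((cellWaveN L n Y).re * h Y : ℝ) : ℂ) - Complex.I * (((cellWaveN L n Y).im * h Y : ℝ) : ℂ) := by
      intro Y
      apply Complex.ext <;> simp [hH]
    have hi1 : IntegrableOn (fun Y => (((cellWaveN L n Y).re * h Y : ℝ) : ℂ)) (cellN N L) volume :=
      (integrableOn_cellN_mul_of_bound hmeas hcell
        (Complex.continuous_re.comp (continuous_cellWaveN L n))).ofReal
    have hi2 : IntegrableOn (fun Y => Complex.I * (((cellWaveN L n Y).im * h Y : ℝ) : ℂ)) (cellN N L)
        volume :=
      (integrableOn_cellN_mul_of_bound hmeas hcell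
        (Complex.continuous_im.comp (continuous_cellWaveN L n))).ofReal.const_mul _
    simp_rw [hpt]
    rw [integral_sub hi1 hi2, integral_const_mul, integral_complex_ofReal, integral_complex_ofReal,
      hre, him]
    simp
  -- the bounded torus function and Parseval
  have hfm : AEStronglyMeasurable (torusFunN L H) volume :=
    (hHm.comp (measurable_fromUnitTorusN L)).aestronglyMeasurable
  have hfb : ∀ t, ‖torusFunN L H t‖ ≤ C := fun t => by
    simp only [torusFunN, hH, Complex.norm_real, Real.norm_eq_abs]
    exact hbdd _ (fromUnitTorusN_mem_closedBoxN hL t)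
  have hf2 : MemLp (torusFunN L H) 2 volume := MemLp.of_bound hfm C (Eventually.of_forall hfb)
  have hP := UnitAddTorus.hasSum_sq_mFourierCoeff (hf2.toLp _)
  have hcoe : ∀ n, UnitAddTorus.mFourierCoeff
      ((hf2.toLp _ : Lp ℂ 2 volume) : UnitAddTorus (Fin N × Fin 3) → ℂ) n =
      configFourierCoeff L H n := fun n =>
    integral_congr_ae (hf2.coeFn_toLp.mono fun t ht => by simp only [ht])
  have hnorm : ∫ t, ‖((hf2.toLp _ : Lp ℂ 2 volume) : UnitAddTorus (Fin N × Fin 3) → ℂ) t‖ ^ 2 =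
      ∫ t, ‖torusFunN L H t‖ ^ 2 :=
    integral_congr_ae (hf2.coeFn_toLp.mono fun t ht => by simp only [ht])
  simp only [hcoe, hcoeff, norm_zero, zero_pow two_ne_zero, hnorm] at hP
  have h0torus : ∫ t, ‖torusFunN L H t‖ ^ 2 = 0 := (hasSum_zero.unique hP).symm
  -- transport to the cell
  have htr := integral_fromUnitTorusN hL (G := fun X : Config N => ‖H X‖ ^ 2)
    (hHm.norm.pow_const 2).aestronglyMeasurable
  simp only [smul_eq_mul] at htr
  have hcellint : ∫ X in cellN N L, ‖H X‖ ^ 2 = 0 := by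
    have hc : (((L ^ 3)⁻¹) ^ N : ℝ) ≠ 0 := pow_ne_zero _ (inv_ne_zero (pow_ne_zero _ hL.ne'))
    have h1 : (((L ^ 3)⁻¹) ^ N : ℝ) * ∫ X in cellN N L, ‖H X‖ ^ 2 = 0 := by
      rw [← htr]
      simpa only [torusFunN] using h0torus
    exact (mul_eq_zero.1 h1).resolve_left hc
  -- a nonnegative integrable function with zero integral vanishes a.e.
  have hi : IntegrableOn (fun X => ‖H X‖ ^ 2) (cellN N L) volume := by
    refine Measure.integrableOn_of_bounded (M := C ^ 2) ?_ (hHm.norm.pow_const 2).aestronglyMeasurable ?_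
    · rw [volume_cellN]; exact ENNReal.pow_ne_top (ENNReal.pow_ne_top ENNReal.ofReal_ne_top)
    · exact (ae_restrict_mem (measurableSet_cellN N L)).mono fun X hX => by
        rw [Real.norm_of_nonneg (sq_nonneg _), hH, Complex.norm_real, Real.norm_eq_abs]
        exact pow_le_pow_left₀ (abs_nonneg _) (hcell X hX) 2
  have hae := (integral_eq_zero_iff_of_nonneg_ae (Eventually.of_forall fun X => sq_nonneg ‖H X‖) hi).1
    hcellint
  filter_upwards [hae] with X hX
  have : ‖H X‖ = 0 := pow_eq_zero_iff two_ne_zero |>.1 hX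
  simpa [hH] using this

/-- **Orthogonality of the residual for integrable data.** If `δ ∈ C²` is a weak corrector of `g`
for a `C¹` lattice-periodic nonvanishing weight `F` on a cell of side `L > 0`, then for every periodic
test function `φ` with `φ g F²` integrable on the cell, `∫ φ (L_F δ + g) F² = 0`
(`IsWeakCorrector.integral_mul_residual_mul_sq` with the continuity of `g` relaxed to integrability).
[cite: BakryGentilLedoux2014, §1.11.3 (1.11.9)] -/
theorem integral_mul_residual_mul_sq_of_integrable {F g δ φ : Config N → ℝ}
    (h : IsWeakCorrector L F g δ) (hL : 0 < L) (hF : ContDiff ℝ 1 F) (hFper : IsLatticePeriodic L F)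
    (h0 : ∀ X, F X ≠ 0) (hδ : ContDiff ℝ 2 δ) (hφ : IsPeriodicTest L φ)
    (hgi : IntegrableOn (fun X => φ X * g X * F X ^ 2) (cellN N L) volume) :
    ∫ X in cellN N L, φ X * (langevinGen F δ X + g X) * F X ^ 2 = 0 := by
  have hδper : IsLatticePeriodic L δ := h.isPeriodicTest.isLatticePeriodic
  have hGreen := integral_mul_langevinGen_mul_sq hL hF hFper h0 hφ hδ hδper
  have hweak : dirichletFormW L F δ φ = ∫ X in cellN N L, φ X * g X * F X ^ 2 := by
    rw [h.dirichletFormW_eq hφ]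
    exact integral_congr_ae (Eventually.of_forall fun X => by ring)
  have hi1 : IntegrableOn (fun X => φ X * langevinGen F δ X * F X ^ 2) (cellN N L) volume :=
    integrableOn_cellN ((hφ.continuous.mul (continuous_langevinGen hF h0 hδ)).mul
      (hF.continuous.pow 2)) L
  calc ∫ X in cellN N L, φ X * (langevinGen F δ X + g X) * F X ^ 2
      = ∫ X in cellN N L, (φ X * langevinGen F δ X * F X ^ 2 + φ X * g X * F X ^ 2) :=
        integral_congr_ae (Eventually.of_forall fun X => by ring)
    _ = -dirichletFormW L F φ δ + dirichletFormW L F δ φ := by rw [integral_add hi1 hgi, hGreen, hweak]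
    _ = 0 := by rw [dirichletFormW_comm]; ring

variable {S δ : Config N → ℝ}

/-- **Weak correctors satisfy the Newton step almost everywhere** (bounded measurable interaction).
For `S, δ ∈ C²` (`S` lattice periodic), a measurable profile `v` with bounded periodic interaction
`W = ∑_{i<j} v^per ≤ Cw < ∞` and a constant `E`: if `δ` is a weak corrector of `E_loc - E` for the
weight `e^{-S}` (`E_loc = ΔS - |∇S|² + W`), then `L_{e^{-S}} δ = -(E_loc - E)` for a.e. `X` in the
fundamental cell (the residual times `e^{-2S}` is bounded, measurable and orthogonal to the test core,
hence zero a.e. by `ae_eq_zero_of_forall_isPeriodicTest_integral_mul_eq_zero`). [folklore] -/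
theorem newtonStep_ae_of_weakCorrector (hL : 0 < L) (hvm : Measurable v) (hCw : Cw ≠ ⊤)
    (hW : ∀ X : Config N, periodicInteraction v L X ≤ Cw) (hS : ContDiff ℝ 2 S)
    (hSper : IsLatticePeriodic L S) (hδ : ContDiff ℝ 2 δ) {E : ℝ}
    (hcorr : IsWeakCorrector L (fun X => Real.exp (-S X))
      (fun X => localKinetic S X + (periodicInteraction v L X).toReal - E) δ) :
    ∀ᵐ X ∂(volume.restrict (cellN N L)), langevinGen (fun Y => Real.exp (-S Y)) δ X =
      -(localKinetic S X + (periodicInteraction v L X).toReal - E) := by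
  have hS1 : ContDiff ℝ 1 S := hS.of_le (by norm_num)
  have hF1 : ContDiff ℝ 1 (fun X => Real.exp (-S X)) := hS1.neg.exp
  have hFper : IsLatticePeriodic L (fun X => Real.exp (-S X)) := hSper.neg.comp Real.exp
  have hF0 : ∀ X, Real.exp (-S X) ≠ 0 := fun X => (Real.exp_pos _).ne'
  have hlk : Continuous (localKinetic S) :=
    (continuous_finsetSum _ fun i _ => continuous_finsetSum _ fun a _ =>
      continuous_pderiv (contDiff_one_pderiv hS i a) i a).sub (continuous_gradDot hS1 hS1)
  have hLc : Continuous (langevinGen (fun Y => Real.exp (-S Y)) δ) := continuous_langevinGen hF1 hF0 hδ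
  have hρ : Continuous fun X => Real.exp (-S X) ^ 2 := hF1.continuous.pow 2
  have hWm : Measurable fun X : Config N => (periodicInteraction v L X).toReal :=
    (measurable_periodicInteraction hvm L).ennreal_toReal
  have hWle : ∀ X : Config N, (periodicInteraction v L X).toReal ≤ Cw.toReal := fun X =>
    ENNReal.toReal_mono hCw (hW X)
  -- the residual times the density
  set r : Config N → ℝ := fun Y => (langevinGen (fun Z => Real.exp (-S Z)) δ Y +
    (localKinetic S Y + (periodicInteraction v L Y).toReal - E)) * Real.exp (-S Y) ^ 2 with hr
  have hrm : Measurable r :=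
    ((hLc.measurable.add ((hlk.measurable.add hWm).sub measurable_const)).mul hρ.measurable)
  -- a bound on the closed box from the continuous part
  set c : Config N → ℝ := fun Y => (|langevinGen (fun Z => Real.exp (-S Z)) δ Y| +
    |localKinetic S Y| + Cw.toReal + |E|) * Real.exp (-S Y) ^ 2 with hc
  have hcc : Continuous c :=
    (((hLc.abs.add hlk.abs).add continuous_const).add continuous_const).mul hρ
  obtain ⟨B, hB⟩ := (isCompact_closedBoxN N L).exists_bound_of_continuousOn hcc.continuousOn
  have hbdd : ∀ X ∈ {X : Config N | ∀ i, X i ∈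
      (WithLp.toLp 2 '' Set.univ.pi fun _ : Fin 3 => Icc (0 : ℝ) L : Set Space)}, |r X| ≤ B := by
    intro X hX
    have h1 := hB X hX
    rw [Real.norm_eq_abs, hc, abs_of_nonneg (mul_nonneg (by positivity) (sq_nonneg _))] at h1
    refine le_trans ?_ h1
    rw [hr, abs_mul, abs_of_nonneg (sq_nonneg (Real.exp (-S X)))]
    refine mul_le_mul_of_nonneg_right ?_ (sq_nonneg _)
    have hW0 : 0 ≤ (periodicInteraction v L X).toReal := ENNReal.toReal_nonneg
    calc |langevinGen (fun Z => Real.exp (-S Z)) δ X +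
          (localKinetic S X + (periodicInteraction v L X).toReal - E)|
        ≤ |langevinGen (fun Z => Real.exp (-S Z)) δ X| +
          |localKinetic S X + (periodicInteraction v L X).toReal - E| := abs_add_le _ _
      _ ≤ |langevinGen (fun Z => Real.exp (-S Z)) δ X| +
          (|localKinetic S X| + Cw.toReal + |E|) := by
          gcongr
          calc |localKinetic S X + (periodicInteraction v L X).toReal - E|
              ≤ |localKinetic S X + (periodicInteraction v L X).toReal| + |E| := abs_sub _ _
            _ ≤ |localKinetic S X| + |(periodicInteraction v L X).toReal| + |E| := by
                gcongr; exact abs_add_le _ _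
            _ ≤ |localKinetic S X| + Cw.toReal + |E| := by
                rw [abs_of_nonneg hW0]; linarith [hWle X]
      _ = |langevinGen (fun Z => Real.exp (-S Z)) δ X| + |localKinetic S X| + Cw.toReal + |E| := by
          ring
  -- orthogonality to the test core
  have horth : ∀ φ : Config N → ℝ, IsPeriodicTest L φ → ∫ Y in cellN N L, φ Y * r Y = 0 := by
    intro φ hφ
    have hgi : IntegrableOn (fun X => φ X * (localKinetic S X + (periodicInteraction v L X).toReal - E) *
        Real.exp (-S X) ^ 2) (cellN N L) volume := by
      have h1 : IntegrableOn (fun X => (localKinetic S X - E) * (φ X * Real.exp (-S X) ^ 2)) (cellN N L)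
          volume := integrableOn_cellN ((hlk.sub continuous_const).mul (hφ.continuous.mul hρ)) L
      have h2 := integrableOn_toReal_interaction_mul hvm hCw hW (hφ.continuous.mul hρ)
      exact (h1.add h2).congr_fun (fun X _ => by simp only [Pi.add_apply, Pi.mul_apply]; ring)
        (measurableSet_cellN N L)
    have h := integral_mul_residual_mul_sq_of_integrable hcorr hL hF1 hFper hF0 hδ hφ hgi
    rw [← h]
    exact integral_congr_ae (Eventually.of_forall fun Y => by simp only [hr]; ring)
  have hae := ae_eq_zero_of_forall_isPeriodicTest_integral_mul_eq_zero hL hrm hbdd horth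
  filter_upwards [hae] with X hX
  simp only [hr, mul_eq_zero, pow_eq_zero_iff two_ne_zero, hF0 X, or_false] at hX
  linarith

/-- **Policy-improvement identity a.e., from the weak equation** (bounded measurable interaction,
`C²` data): under the hypotheses of `newtonStep_ae_of_weakCorrector` with `E = Ē`, the local energy
of `e^{-(S+δ)}` equals `Ē - |∇δ|²` for a.e. `X` in the fundamental cell. [folklore] -/
theorem localEnergy_newtonStep_ae (hL : 0 < L) (hvm : Measurable v) (hCw : Cw ≠ ⊤)
    (hW : ∀ X : Config N, periodicInteraction v L X ≤ Cw) (hS : ContDiff ℝ 2 S)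
    (hSper : IsLatticePeriodic L S) (hδ : ContDiff ℝ 2 δ) {E : ℝ}
    (hcorr : IsWeakCorrector L (fun X => Real.exp (-S X))
      (fun X => localKinetic S X + (periodicInteraction v L X).toReal - E) δ) :
    ∀ᵐ X ∂(volume.restrict (cellN N L)),
      localKinetic (S + δ) X + (periodicInteraction v L X).toReal = E - gradDot δ δ X := by
  filter_upwards [newtonStep_ae_of_weakCorrector hL hvm hCw hW hS hSper hδ hcorr] with X hX
  exact localKinetic_add_of_newtonStep (V := fun Y => (periodicInteraction v L Y).toReal) hS hδ hX

end AE

end PolicyImprovement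

end Summit.AtomisticToContinuum.BoseEinsteinCondensation.Theorems

end
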